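import Mathlib
import Literature.NumberTheory.LFunctions.Zhang2022.Section2Assembly
import Literature.NumberTheory.LFunctions.Zhang2022.Section2CriticalLineReality
import Literature.NumberTheory.LFunctions.Zhang2022.Section2SmoothWeight
import Literature.NumberTheory.LFunctions.Zhang2022.Section2FrakP
import Literature.NumberTheory.LFunctions.RHWave0
import HarnessLib

/-!
# Zhang (2022), typed skeleton I: the setting — the parameters of §2, the family `Ψ`,
# Assumption (A), and Theorems 1–2 as `Prop`s

Topic `Literature/NumberTheory/LFunctions/Zhang2022` (Landau–Siegel audit tree; verdict-neutral).
Y. Zhang, *Discrete mean estimates and the Landau–Siegel zero*, arXiv:2211.02515v1 (2022)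
[Zhang2022LandauSiegel] — **an unrefereed manuscript under adjudication. Nothing in this file
asserts or denies its Theorems 1–2.** This is the first of the `Skeleton*` files, whose purpose is
to make every load-bearing intermediate claim of the manuscript a NAMED `Prop` about REAL objects
(so that a referee's gap at equation `(x.y)` is a named hypothesis of a kernel-checked implication),
and to kernel-check the implications between them that the manuscript's §2 and §18 assert.

This file fixes, as functions of the modulus `D` of the exceptional character `χ`:

* the parameters `𝓛 = log D` (2.1), `P = exp 𝓛⁹` (2.6), `α = π/log P` (2.10), `t₀ = 𝓛⁵¹⁹`,
  `𝓛₁ = 𝓛⁴⁰⁵`, `s₀ = ½ + 2πit₀` (2.8), `𝓛₂ = 𝓛⁴⁰⁰` (2.15), `T = exp 𝓛^{1.1}` (§6),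
  `P₁, P₂, P₃` (2.21), `P₄ = PT⁻²t₀` (§6), the region `Ω` (2.7), the prime window `p ∼ P`
  (`P < p < P(1 + 𝓛⁻⁶⁸)`) and `𝔓 = Σ_{p∼P} p` (2.9) (= the tree's `frakP`, `frakP_eq_sum_primeWindow`);
* the family `Ψ` of all primitive characters `ψ (mod p)`, `p ∼ P`, as a TYPE `Chr D` (a record
  `⟨p, p ∼ P, ψ, ψ primitive⟩`; it is finite, `Chr.instFinite`);
* **Assumption (A)** `L(1,χ) < 𝓛⁻²⁰²²` (§2 p. 4) as `AssumptionA D χ` — typed, as printed, with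
  the strict `<`, for the norm `‖L(1,χ)‖` (for a real character `L(1,χ)` is real and positive);
  it implies the `≤ 1/𝓛²⁰²²` form consumed by the tree's `Section3Lemma3*` files and is the
  `< (𝓛²⁰²²)⁻¹` form of its `Section5ExceptionalZero` / `Section5Lemma56Printed`;
* **Theorem 1** (`L(1,χ) > c₁(log D)⁻²⁰²²`) and **Theorem 2** (`L(σ,χ) ≠ 0` for
  `σ > 1 − c₂(log D)⁻²⁰²⁴`) as `Prop`s (`Theorem1 = LOneLowerBound 2022`,
  `Theorem2 = ZeroFreeRegion 2024`; `ZeroFreeRegion 1` is literally the tree's conjecture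
  `NoSiegelZeros`, `zeroFreeRegion_one_iff`), tagged as claims under review;

and PROVES the two book-ends of the argument that do not depend on the discrete means:

* `theorem2_of_theorem1` — §1 p. 3 "As a direct consequence of Theorem 1 we have Theorem 2"
  (the tree's `Zhang2022.zeroFree_of_LOne_lower_bound`, Montgomery–Vaughan (11.10));
* `theorem1_of_eventually_not_assumptionA` — §2 p. 4/p. 6: the proof refutes (A) for `D`
  "greater than a sufficiently large … number" `D₀`; Theorem 1 then follows with
  `c₁ = min(½, ½·min L(1,χ)(log D)²⁰²²)` over the finitely many real primitive characters to moduli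
  `3 ≤ D < D₀` (each `L(1,χ) ≠ 0`, Mathlib's `LFunction_ne_zero_of_one_le_re`).

Deliberately NOT here: `Ψ₁`, the zeros, `𝔠*`, the Dirichlet polynomials and the discrete means
(`SkeletonObjects`), the named Propositions 2.1–2.6 etc. (`SkeletonPropositions`), the §2/§18
assembly (`SkeletonAssembly`). Companion: the adjudication cell's HOME/STATUS.md.

## References

* Y. Zhang, arXiv:2211.02515v1 (2022), §1 (Theorems 1, 2), §2 (2.1), (2.6)–(2.10), (2.15),
  (2.21), Assumption (A); §6 (`T`, `P₄`). [cite: Zhang2022LandauSiegel, §§1–2]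
* H. L. Montgomery, R. C. Vaughan, *Multiplicative Number Theory I* (2007), Thm. 11.4 / (11.10)
  (consumed via the tree's `Section2Assembly.zeroFree_of_LOne_lower_bound`).
  [cite: MontgomeryVaughan2007, Thm. 11.4]
-/

noncomputable section

open Complex Real

namespace Literature.NumberTheory.LFunctions.Zhang2022.Skeleton

/-! ## The parameters of §2 as functions of `D` -/

/-- `𝓛 = log D` (2.1). [cite: Zhang2022LandauSiegel, §2 (2.1)] -/
def ell (D : ℕ) : ℝ := Real.log D

/-- `P = exp{𝓛⁹}` (2.6). [cite: Zhang2022LandauSiegel, §2 (2.6)] -/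
def bigP (D : ℕ) : ℝ := Real.exp (ell D ^ 9)

/-- `α = π / log P` (2.10), "the average gap between consecutive zeros … is ≃ α".
[cite: Zhang2022LandauSiegel, §2 (2.10)] -/
def alpha (D : ℕ) : ℝ := Real.pi / Real.log (bigP D)

/-- `t₀ = 𝓛⁵¹⁹` (2.8). [cite: Zhang2022LandauSiegel, §2 (2.8)] -/
def t0 (D : ℕ) : ℝ := ell D ^ 519

/-- `𝓛₁ = 𝓛⁴⁰⁵` (2.8), the half-height of `Ω`. [cite: Zhang2022LandauSiegel, §2 (2.8)] -/
def ell1 (D : ℕ) : ℝ := ell D ^ 405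

/-- `𝓛₂ = 𝓛⁴⁰⁰` (2.15), the width of the weight `ω`. [cite: Zhang2022LandauSiegel, §2 (2.15)] -/
def ell2 (D : ℕ) : ℝ := ell D ^ 400

/-- `s₀ = 1/2 + 2πit₀` (2.8) (the tree's `SmoothWeight.s0`). [cite: Zhang2022LandauSiegel, §2 (2.8)] -/
def s0 (D : ℕ) : ℂ := SmoothWeight.s0 (t0 D)

/-- `T = exp{𝓛^{1.1}}` (§6, p. 12). [cite: Zhang2022LandauSiegel, §6] -/
def bigT (D : ℕ) : ℝ := Real.exp (ell D ^ (1.1 : ℝ))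

/-- `P₁ = P^{0.504}` (2.21). [cite: Zhang2022LandauSiegel, §2 (2.21)] -/
def P1 (D : ℕ) : ℝ := bigP D ^ (0.504 : ℝ)

/-- `P₂ = P^{0.5}T^{−10}` (2.21). [cite: Zhang2022LandauSiegel, §2 (2.21)] -/
def P2 (D : ℕ) : ℝ := bigP D ^ (0.5 : ℝ) / bigT D ^ 10

/-- `P₃ = P^{0.498}` (2.21). [cite: Zhang2022LandauSiegel, §2 (2.21)] -/
def P3 (D : ℕ) : ℝ := bigP D ^ (0.498 : ℝ)

/-- `P₄ = PT⁻²t₀` (§6, p. 12). [cite: Zhang2022LandauSiegel, §6] -/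
def P4 (D : ℕ) : ℝ := bigP D / bigT D ^ 2 * t0 D

/-- `α̃ = log(Dt₀)/log P` (2.30). [cite: Zhang2022LandauSiegel, §2 (2.30)] -/
def alphaTilde (D : ℕ) : ℝ := Real.log (D * t0 D) / Real.log (bigP D)

/-- The region `Ω = {s : |Re(s − s₀)| < 1/2, |Im(s − s₀)| < 𝓛₁ + 2}` (2.7).
[cite: Zhang2022LandauSiegel, §2 (2.7)] -/
def Omega (D : ℕ) : Set ℂ :=
  {s | |(s - s0 D).re| < 1 / 2 ∧ |(s - s0 D).im| < ell1 D + 2}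

/-- The prime window "`p ∼ P` for `P < p < P(1 + 𝓛⁻⁶⁸)`" (§2 p. 4), as a finite set of primes.
[cite: Zhang2022LandauSiegel, §2 p. 4] -/
def primeWindow (D : ℕ) : Finset ℕ :=
  (Finset.Ioo ⌊bigP D⌋₊ ⌈bigP D * (1 + (ell D ^ 68)⁻¹)⌉₊).filter Nat.Prime

/-- `𝔓 := Σ_{p∼P} p` (2.9) is the tree's `frakP D`, i.e. the sum over `primeWindow D`.
[cite: Zhang2022LandauSiegel, §2 (2.9)] -/
theorem frakP_eq_sum_primeWindow (D : ℕ) : frakP D = ∑ p ∈ primeWindow D, (p : ℝ) := rfl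

/-- Members of the prime window are prime. [folklore] -/
private theorem prime_of_mem_primeWindow {D p : ℕ} (h : p ∈ primeWindow D) : p.Prime :=
  (Finset.mem_filter.mp h).2

/-! ## The family `Ψ` -/

/-- **The family `Ψ`** "of all primitive characters `ψ (mod p)` with `p ∼ P`" (§2 p. 4), as a type:
a member is a prime `p` of the window together with a primitive character `ψ` mod `p`.
[cite: Zhang2022LandauSiegel, §2 p. 4] -/
structure Chr (D : ℕ) where
  /-- the modulus `p ∼ P` -/
  p : ℕ
  /-- `P < p < P(1 + 𝓛⁻⁶⁸)`, `p` prime -/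
  mem : p ∈ primeWindow D
  /-- the character `ψ (mod p)` -/
  ψ : DirichletCharacter ℂ p
  /-- `ψ` is primitive -/
  prim : ψ.IsPrimitive

namespace Chr

variable {D : ℕ}

/-- The modulus of a member of `Ψ` is prime ("`p` and `q` denote primes", §2 p. 3; `p ∼ P`).
[cite: Zhang2022LandauSiegel, §2 p. 4] -/
theorem prime (x : Chr D) : x.p.Prime := prime_of_mem_primeWindow x.mem

/-- The modulus of a member of `Ψ` is non-zero (so that `L(s,ψ)`, `Z(s,ψ)` make sense). [folklore] -/
instance instNeZero (x : Chr D) : NeZero x.p := ⟨x.prime.ne_zero⟩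

/-- The modulus of a member of `Ψ` is prime, as an instance. [folklore] -/
instance instFactPrime (x : Chr D) : Fact x.p.Prime := ⟨x.prime⟩

/-- The modulus of a member of `Ψ` is not `1` (so that `ψ ≠ 1`); `p ∼ P` is prime.
[cite: Zhang2022LandauSiegel, §2 p. 4] -/
theorem p_ne_one (x : Chr D) : x.p ≠ 1 := x.prime.ne_one

/-- A member `ψ (mod p)` of `Ψ` is non-principal (primitive to a prime modulus).
[cite: Zhang2022LandauSiegel, §2 p. 4] -/
theorem ψ_ne_one (x : Chr D) : x.ψ ≠ 1 := GammaFactor.ne_one_of_isPrimitive x.prim x.p_ne_one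

/-- Moduli in the window are non-zero, as an instance on the window's subtype. [folklore] -/
instance instNeZeroWindow (q : primeWindow D) : NeZero (q : ℕ) :=
  ⟨(prime_of_mem_primeWindow q.2).ne_zero⟩

/-- `Ψ` embeds in the finite type `Σ_{p ∼ P} (characters mod p)`. [folklore] -/
def toSigma (x : Chr D) : (q : primeWindow D) × DirichletCharacter ℂ (q : ℕ) :=
  ⟨⟨x.p, x.mem⟩, x.ψ⟩

/-- `toSigma` is injective. [folklore] -/
private theorem toSigma_injective : Function.Injective (toSigma (D := D)) := by
  rintro ⟨p, hp, ψ, hψ⟩ ⟨p', hp', ψ', hψ'⟩ h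
  simp only [toSigma, Sigma.mk.injEq, Subtype.mk.injEq] at h
  obtain ⟨rfl, h2⟩ := h
  simp only [heq_eq_eq] at h2
  subst h2
  rfl

/-- **`Ψ` is finite** (finitely many primes in the window, finitely many characters to each).
[folklore] -/
instance instFinite : Finite (Chr D) := Finite.of_injective _ toSigma_injective

end Chr

/-! ## Assumption (A) and the two theorems, as `Prop`s -/

/-- **Assumption (A)** (§2 p. 4): "`L(1,χ) < 𝓛⁻²⁰²²`", `𝓛 = log D`, for the real primitive
character `χ (mod D)` — the hypothesis the manuscript sets out to refute for large `D`. Typed with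
the printed strict `<` for `‖L(1,χ)‖` (see the module docstring).
[cite: Zhang2022LandauSiegel, §2 Assumption (A)] -/
def AssumptionA (D : ℕ) [NeZero D] (χ : DirichletCharacter ℂ D) : Prop :=
  ‖χ.LFunction 1‖ < 1 / Real.log D ^ 2022

/-- The shape of Theorem 1 with a general exponent `A`: there is an absolute `c₁ > 0` with
`L(1,χ) > c₁(log D)^{−A}` for every real primitive character `χ` to a modulus `D ≥ 3`
(`‖L(1,χ)‖`; for real `χ`, `L(1,χ)` is real and positive). [cite: Zhang2022LandauSiegel, §1 Theorem 1] -/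
def LOneLowerBound (A : ℕ) : Prop :=
  ∃ c₁ : ℝ, 0 < c₁ ∧ ∀ (D : ℕ) [NeZero D] (χ : DirichletCharacter ℂ D),
    3 ≤ D → χ.IsQuadratic → χ.IsPrimitive → c₁ / Real.log D ^ A < ‖χ.LFunction 1‖

/-- **Theorem 1 of the manuscript** (§1): "If `χ` is a real primitive character to the modulus `D`,
then `L(1,χ) > c₁(log D)⁻²⁰²²` where `c₁ > 0` is an absolute, effectively computable constant."
A CLAIM UNDER ADJUDICATION — stated, not asserted (arXiv:2211.02515v1, §1, Theorem 1). -/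
@[claim "Zhang2022LandauSiegel" "under-review"]
def Theorem1 : Prop := LOneLowerBound 2022

/-- The shape of Theorem 2 with a general exponent `A`: there is an absolute `c₂ > 0` with
`L(σ,χ) ≠ 0` for `σ > 1 − c₂(log D)^{−A}`, every real primitive `χ` mod `D ≥ 3`.
(`A = 1` is the classical shape `σ > 1 − c/log D`, the tree's `NoSiegelZeros`: `zeroFreeRegion_one_iff`.)
[cite: Zhang2022LandauSiegel, §1 Theorem 2] -/
def ZeroFreeRegion (A : ℕ) : Prop :=
  ∃ c₂ : ℝ, 0 < c₂ ∧ ∀ (D : ℕ) [NeZero D] (χ : DirichletCharacter ℂ D),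
    3 ≤ D → χ.IsQuadratic → χ.IsPrimitive →
      ∀ σ : ℝ, 1 - c₂ / Real.log D ^ A < σ → χ.LFunction σ ≠ 0

/-- **Theorem 2 of the manuscript** (§1): "`L(σ,χ) ≠ 0` for `σ > 1 − c₂(log D)⁻²⁰²⁴` where
`c₂ > 0` is an absolute, effectively computable constant." A CLAIM UNDER ADJUDICATION — stated,
not asserted (arXiv:2211.02515v1, §1, Theorem 2). -/
@[claim "Zhang2022LandauSiegel" "under-review"]
def Theorem2 : Prop := ZeroFreeRegion 2024

/-- `ZeroFreeRegion 1` is, word for word, the tree's `NoSiegelZeros` (rh.S34, the region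
`σ > 1 − c/log q` free of real zeros, Davenport Ch. 14): Theorem 2 is its `(log D)⁻²⁰²⁴`-weakening.
[cite: DavenportMNT1980, Ch. 14] -/
theorem zeroFreeRegion_one_iff :
    ZeroFreeRegion 1 ↔ Literature.NumberTheory.LFunctions.NoSiegelZeros := by
  simp only [ZeroFreeRegion, Literature.NumberTheory.LFunctions.NoSiegelZeros, pow_one]
  constructor
  · rintro ⟨c, hc, h⟩
    exact ⟨c, hc, fun q _ hq χ hquad hprim σ hσ => h q χ hq hquad hprim σ hσ⟩
  · rintro ⟨c, hc, h⟩
    exact ⟨c, hc, fun q _ χ hq hquad hprim σ hσ => h q hq χ hquad hprim σ hσ⟩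

/-! ## Theorem 1 ⇒ Theorem 2 (§1 p. 3) -/

/-- A primitive character to a modulus `D ≥ 3` is non-principal (the principal character has
conductor `1`). [cite: DavenportMNT1980, Ch. 5] -/
theorem ne_one_of_isPrimitive_of_three_le {D : ℕ} [NeZero D] {χ : DirichletCharacter ℂ D}
    (hχ : χ.IsPrimitive) (hD : 3 ≤ D) : χ ≠ 1 :=
  GammaFactor.ne_one_of_isPrimitive hχ (by omega)

/-- The general exponent shift `A ↦ A + 2` behind "Theorem 1 ⇒ Theorem 2": a lower bound
`L(1,χ) > c₁(log D)^{−A}` for all real primitive `χ` gives the zero-free region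
`σ > 1 − c₂(log D)^{−(A+2)}` (the tree's `zeroFree_of_LOne_lower_bound`: Montgomery–Vaughan
(11.10) `L(1,χ) ≪ (1 − β₁)log²q` supplies the unstated `+2`). [cite: Zhang2022LandauSiegel, §1 p. 3] -/
theorem zeroFreeRegion_of_lOneLowerBound (A : ℕ) (h : LOneLowerBound A) :
    ZeroFreeRegion (A + 2) := by
  obtain ⟨c₁, hc₁, h1⟩ := h
  obtain ⟨c₂, hc₂, h2⟩ := zeroFree_of_LOne_lower_bound A hc₁
  refine ⟨c₂, hc₂, fun D _ χ hD hquad hprim σ hσ => ?_⟩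
  have hne : χ ≠ 1 := ne_one_of_isPrimitive_of_three_le hprim hD
  have hb : c₁ * (Real.log D)⁻¹ ^ A < ‖χ.LFunction 1‖ := by
    have := h1 D χ hD hquad hprim
    rwa [inv_pow, ← div_eq_mul_inv]
  refine h2 D χ hne hquad hD hb σ ?_
  rwa [inv_pow, ← div_eq_mul_inv]

/-- **§1 p. 3: "As a direct consequence of Theorem 1 we have Theorem 2"** (`2024 = 2022 + 2`),
kernel-checked as an implication between the two `Prop`s. [cite: Zhang2022LandauSiegel, §1 p. 3] -/
theorem theorem2_of_theorem1 (h : Theorem1) : Theorem2 :=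
  zeroFreeRegion_of_lOneLowerBound 2022 h

/-! ## From "(A) fails for all large `D`" to Theorem 1 (§2 p. 4, p. 6) -/

/-- On a finite index type a pointwise-positive real function is bounded below by a positive
constant, strictly. [folklore] -/
private theorem exists_pos_lt_of_finite {ι : Type*} [Finite ι] (f : ι → ℝ) (hf : ∀ i, 0 < f i) :
    ∃ c : ℝ, 0 < c ∧ ∀ i, c < f i := by
  cases isEmpty_or_nonempty ι with
  | inl h => exact ⟨1, one_pos, fun i => (IsEmpty.false i).elim⟩
  | inr h =>
    obtain ⟨i₀, hi₀⟩ := Finite.exists_min f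
    exact ⟨f i₀ / 2, by linarith [hf i₀], fun i => by linarith [hf i₀, hi₀ i]⟩

/-- `log D > 1` for `D ≥ 3`. [folklore] -/
private theorem one_lt_log_of_three_le {D : ℕ} (hD : 3 ≤ D) : 1 < Real.log D := by
  have hD' : (3 : ℝ) ≤ D := by exact_mod_cast hD
  calc (1 : ℝ) < Real.log 3 := by
        rw [Real.lt_log_iff_exp_lt (by norm_num)]
        exact Real.exp_one_lt_d9.trans (by norm_num)
    _ ≤ Real.log D := Real.log_le_log (by norm_num) hD'

/-- **"`D` greater than a sufficiently large … number" (§2 p. 4) costs nothing**: if Assumption (A)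
fails for every real primitive character to every modulus `D ≥ D₀`, then Theorem 1 holds — with
`c₁ = min(1/2, c)` where `c < L(1,χ)(log D)²⁰²²` for the finitely many non-principal characters
to moduli `3 ≤ D < D₀` (each `L(1,χ) ≠ 0`). This is the step "Under Assumption (A), a contradiction …
This proves Theorem 1" (§2 p. 6) minus the contradiction itself.
[cite: Zhang2022LandauSiegel, §2 p. 4, p. 6] -/
theorem theorem1_of_eventually_not_assumptionA
    (h : ∃ D₀ : ℕ, ∀ (D : ℕ) [NeZero D] (χ : DirichletCharacter ℂ D),
      D₀ ≤ D → χ.IsQuadratic → χ.IsPrimitive → ¬ AssumptionA D χ) :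
    Theorem1 := by
  obtain ⟨D₀, hD₀⟩ := h
  -- the finitely many non-principal characters to moduli `e + 3`, `e < D₀`
  let ι := (e : Fin D₀) × {χ : DirichletCharacter ℂ ((e : ℕ) + 3) // χ ≠ 1}
  let f : ι → ℝ := fun i => ‖i.2.1.LFunction 1‖ * Real.log (((i.1 : ℕ) + 3 : ℕ) : ℝ) ^ 2022
  have hf : ∀ i, 0 < f i := by
    rintro ⟨e, χ, hχ⟩
    have hlog : 0 < Real.log ((((e : ℕ) + 3 : ℕ) : ℝ)) :=
      lt_trans one_pos (one_lt_log_of_three_le (by omega))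
    have hL : χ.LFunction 1 ≠ 0 :=
      DirichletCharacter.LFunction_ne_zero_of_one_le_re χ (Or.inl hχ) (by simp)
    exact mul_pos (norm_pos_iff.mpr hL) (pow_pos hlog _)
  obtain ⟨c, hc, hcf⟩ := exists_pos_lt_of_finite f hf
  refine ⟨min (1 / 2) c, lt_min (by norm_num) hc, fun D _ χ hD hquad hprim => ?_⟩
  have hlog : 0 < Real.log D := lt_trans one_pos (one_lt_log_of_three_le hD)
  have hpow : 0 < Real.log D ^ 2022 := pow_pos hlog _
  by_cases hlarge : D₀ ≤ D
  · -- large `D`: (A) fails, i.e. `‖L(1,χ)‖ ≥ 𝓛⁻²⁰²² > min(1/2,c)·𝓛⁻²⁰²²`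
    have hA := hD₀ D χ hlarge hquad hprim
    rw [AssumptionA, not_lt] at hA
    calc min (1 / 2) c / Real.log D ^ 2022 ≤ (1 / 2) / Real.log D ^ 2022 :=
          div_le_div_of_nonneg_right (min_le_left _ _) hpow.le
      _ < 1 / Real.log D ^ 2022 := div_lt_div_of_pos_right (by norm_num) hpow
      _ ≤ ‖χ.LFunction 1‖ := hA
  · -- small `D`: one of the finitely many characters
    push Not at hlarge
    obtain ⟨e, rfl⟩ : ∃ e : ℕ, D = e + 3 := ⟨D - 3, by omega⟩
    have he : e < D₀ := by omega
    have hne : χ ≠ 1 := ne_one_of_isPrimitive_of_three_le hprim hD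
    have key := hcf ⟨⟨e, he⟩, ⟨χ, hne⟩⟩
    simp only [f] at key
    calc min (1 / 2) c / Real.log ((e + 3 : ℕ) : ℝ) ^ 2022
        ≤ c / Real.log ((e + 3 : ℕ) : ℝ) ^ 2022 :=
          div_le_div_of_nonneg_right (min_le_right _ _) hpow.le
      _ < ‖χ.LFunction 1‖ := by rwa [div_lt_iff₀ hpow]

end Literature.NumberTheory.LFunctions.Zhang2022.Skeleton
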